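import Literature.NumberTheory.EllipticCurves.ModularFormsGamma0Rank
import Literature.NumberTheory.EllipticCurves.CuspFormsGamma1EisensteinDivision
import Literature.NumberTheory.ModularForms.SturmCongruenceNorm
import Mathlib.Algebra.Module.Submodule.Union
import HarnessLib

/-!
# `K`-rational `q_N`-expansions of forms on `Γ(N)`: the algebra (set-up for the `q`-expansion
# principle for `SL₂(ℤ)`-translates)

Topic `Literature/NumberTheory/ModularForms`; namespace `Literature.NumberTheory.ModularForms`.
First of three files proving that the `SL₂(ℤ)`-translates of a modular form on `Γ(N)` whose
`q_N`-expansion has coefficients in a field `K ⊇ ℚ(ζ_N)` again have `q_N`-expansions with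
coefficients in `K` (Shimura, *Introduction to the arithmetic theory of automorphic functions*,
Thm. 6.6 with Prop. 6.9 and (6.1.3); Diamond–Shurman §4.2–4.3 for the Eisenstein input), the
rationality half of the `q`-expansion principle at all cusps used by Sturm's congruence theorem
(`SturmCongruenceProofs`).  This file is the bookkeeping, in the language of the tree's
`formSpace Γ k ⊆ (ℍ → ℂ)` (`ModularFormsGamma0FreeModule`):

* `IsRat K N f` — every coefficient of Mathlib's `qExpansion N f` lies in the subfield `K ⊆ ℂ`
  (definition of a predicate); closure under `+`, `•`, `*`, `^`, `∑` for members of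
  `formSpace Γ(N) k` (Mathlib's `qExpansion_add/_mul/_smul` for functions with analytic cusp
  function);
* `IsRat.of_mul_left` — **division**: `d q = r` with `d ≢ 0`, `d, r` `K`-rational ⟹ `q`
  `K`-rational (power series over a field: solve for the coefficients of `q` recursively);
* `slash_mem_formSpace_Gamma` — `Γ(N)` is normal in `SL₂(ℤ)`, so translates of forms on `Γ(N)`
  are forms on `Γ(N)`;
* `levelOneSpace_le_span_isRat` — `M_w(SL₂(ℤ))` is spanned over `ℂ` by forms with RATIONAL
  `q`-expansions (monomials in `E₄, E₆`; from the tree's `levelOneSpace_le_sup` and Mathlib's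
  `E_k = 1 - (2k/B_k)∑σ_{k-1}(n)qⁿ`), Shimura (6.1.3)/Thm. 3.52-type statement at level one;
* `exists_coords_mem_of_forall_mem` — **descent of linear relations**: a `K`-rational vector which
  is a `ℂ`-combination of `K`-rational vectors is a `K`-combination of them (apply a `K`-linear
  retraction `ℂ → K` coefficientwise), the linear-disjointness step of Shimura's proof of Prop. 6.9.

Everything is proved; the one definition is the predicate `IsRat` (no named fact).

## References

* [ShimuraIATAF1971] G. Shimura, *Introduction to the arithmetic theory of automorphic
  functions*, Princeton (1971), §6.1–6.2: (6.1.3), Thm. 6.6, Prop. 6.9; Thm. 3.52.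
* [DiamondShurman2005] F. Diamond, J. Shurman, *A First Course in Modular Forms*, GTM 228
  (2005), §1.1–1.2 (level one), §4.2–4.3.
-/

noncomputable section

namespace Literature.NumberTheory.ModularForms

open scoped MatrixGroups Real CongruenceSubgroup Matrix ModularForm Topology Manifold
open UpperHalfPlane hiding I
open Complex Filter Function PowerSeries ModularForm
open Literature.NumberTheory.EllipticCurves.ModularForms (formSpace levelOneSpace mem_formSpace
  mem_formSpace_iff coe_mem_formSpace mul_mem_formSpace pow_mem_formSpace formSpace_mono
  mdifferentiable_of_mem_formSpace slash_eq_of_mem_formSpace isBoundedAtImInfty_slash_of_mem_formSpace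
  formSpace_eq_bot_of_neg levelOneSpace_le_sup E4_mem E6_mem eq_zero_of_mul_eq_zero_of_mdifferentiable
  exists_int_map_eq_qExpansion_E₄ exists_int_map_eq_qExpansion_E₆)

/-! ### The predicate and its algebra on `formSpace Γ(N) k` -/

section IsRat

variable (K : Subfield ℂ) (N : ℕ)

/-- **`K`-rationality of the `q_N`-expansion**: every coefficient of Mathlib's `qExpansion N f`
(`q_N = e^{2πiτ/N}`) of `f : ℍ → ℂ` lies in the subfield `K ⊆ ℂ` (Shimura §6.1: "Fourier
coefficients in `k`"). [cite: ShimuraIATAF1971, §6.1 (6.1.3)] -/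
def IsRat (f : ℍ → ℂ) : Prop := ∀ n : ℕ, (qExpansion (N : ℝ) f).coeff n ∈ K

variable {K N} [NeZero N]

/-- The cusp function of a member of `formSpace Γ(N) k` is analytic at `0` (period `N`). [folklore] -/
theorem analyticAt_cuspFunction_of_mem {k : ℤ} {f : ℍ → ℂ}
    (hf : f ∈ formSpace (CongruenceSubgroup.Gamma N) k) :
    AnalyticAt ℂ (cuspFunction (N : ℝ) f) 0 := by
  obtain ⟨F, rfl⟩ := hf
  exact ModularFormClass.analyticAt_cuspFunction_zero F (Nat.cast_pos.mpr (NeZero.pos N))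
    (natCast_mem_strictPeriods_Gamma N)

/-- `q`-expansion injectivity on `formSpace Γ(N) k`. [folklore] -/
theorem eq_of_qExpansion_eq_of_mem {k : ℤ} {f g : ℍ → ℂ}
    (hf : f ∈ formSpace (CongruenceSubgroup.Gamma N) k)
    (hg : g ∈ formSpace (CongruenceSubgroup.Gamma N) k)
    (h : qExpansion (N : ℝ) f = qExpansion (N : ℝ) g) : f = g := by
  obtain ⟨F, rfl⟩ := hf
  obtain ⟨G, rfl⟩ := hg
  have hsub : qExpansion (N : ℝ) (⇑(F - G)) = 0 := by
    rw [ModularForm.coe_sub, ModularForm.qExpansion_sub (Nat.cast_pos.mpr (NeZero.pos N)) (natCast_mem_strictPeriods_Gamma N) F G,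
      h, sub_self]
  have := (ModularForm.qExpansion_eq_zero_iff (Nat.cast_pos.mpr (NeZero.pos N)) (natCast_mem_strictPeriods_Gamma N) (F - G)).mp hsub
  have h2 : (⇑(F - G) : ℍ → ℂ) = 0 := by rw [this]; rfl
  rw [ModularForm.coe_sub] at h2
  exact sub_eq_zero.mp h2

omit [NeZero N] in
/-- The zero function is `K`-rational. [folklore] -/
theorem isRat_zero : IsRat K N (0 : ℍ → ℂ) := fun n ↦ by
  rw [qExpansion_zero, map_zero]
  exact zero_mem K

omit [NeZero N] in
/-- The constant function `1` is `K`-rational. [folklore] -/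
theorem isRat_one : IsRat K N (1 : ℍ → ℂ) := fun n ↦ by
  rw [qExpansion_one, PowerSeries.coeff_one]
  split_ifs
  · exact one_mem K
  · exact zero_mem K

/-- Sums. [folklore] -/
theorem IsRat.add {k : ℤ} {f g : ℍ → ℂ} (hf : f ∈ formSpace (CongruenceSubgroup.Gamma N) k)
    (hg : g ∈ formSpace (CongruenceSubgroup.Gamma N) k) (hfK : IsRat K N f) (hgK : IsRat K N g) :
    IsRat K N (f + g) := fun n ↦ by
  rw [qExpansion_add (analyticAt_cuspFunction_of_mem hf) (analyticAt_cuspFunction_of_mem hg),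
    map_add]
  exact add_mem (hfK n) (hgK n)

/-- Scalar multiples by elements of `K`. [folklore] -/
theorem IsRat.smul {k : ℤ} {f : ℍ → ℂ} (hf : f ∈ formSpace (CongruenceSubgroup.Gamma N) k)
    (hfK : IsRat K N f) {c : ℂ} (hc : c ∈ K) : IsRat K N (c • f) := fun n ↦ by
  rw [qExpansion_smul (analyticAt_cuspFunction_of_mem hf), map_smul, smul_eq_mul]
  exact mul_mem hc (hfK n)

/-- Products (of forms of possibly different weights). [folklore] -/
theorem IsRat.mul {k₁ k₂ : ℤ} {f g : ℍ → ℂ} (hf : f ∈ formSpace (CongruenceSubgroup.Gamma N) k₁)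
    (hg : g ∈ formSpace (CongruenceSubgroup.Gamma N) k₂) (hfK : IsRat K N f) (hgK : IsRat K N g) :
    IsRat K N (f * g) := fun n ↦ by
  rw [qExpansion_mul (analyticAt_cuspFunction_of_mem hf) (analyticAt_cuspFunction_of_mem hg),
    PowerSeries.coeff_mul]
  exact sum_mem fun p _ ↦ mul_mem (hfK _) (hgK _)

/-- Powers. [folklore] -/
theorem IsRat.pow {k : ℤ} {f : ℍ → ℂ} (hf : f ∈ formSpace (CongruenceSubgroup.Gamma N) k)
    (hfK : IsRat K N f) (m : ℕ) : IsRat K N (f ^ m) := by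
  induction m with
  | zero => rw [pow_zero]; exact isRat_one
  | succ m ih =>
    rw [pow_succ]
    exact IsRat.mul (pow_mem_formSpace hf m) hf ih hfK

/-- Finite sums of forms of a common weight. [folklore] -/
theorem IsRat.sum {ι : Type*} {k : ℤ} (s : Finset ι) {f : ι → ℍ → ℂ}
    (hf : ∀ i ∈ s, f i ∈ formSpace (CongruenceSubgroup.Gamma N) k)
    (hfK : ∀ i ∈ s, IsRat K N (f i)) : IsRat K N (∑ i ∈ s, f i) := by
  classical
  induction s using Finset.induction_on with
  | empty => rw [Finset.sum_empty]; exact isRat_zero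
  | insert a s ha ih =>
    rw [Finset.sum_insert ha]
    have hs : ∀ i ∈ s, f i ∈ formSpace (CongruenceSubgroup.Gamma N) k :=
      fun i hi ↦ hf i (Finset.mem_insert_of_mem hi)
    exact IsRat.add (hf a (Finset.mem_insert_self a s)) (Submodule.sum_mem _ hs) (hfK a (Finset.mem_insert_self a s))
      (ih hs fun i hi ↦ hfK i (Finset.mem_insert_of_mem hi))

end IsRat

/-! ### Division -/

section Division

variable {K : Subfield ℂ}

/-- **Division of power series preserves `K`-rationality**: if `P Q = R` in `ℂ⟦X⟧` with `P ≠ 0`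
and `P`, `R` have all coefficients in the subfield `K`, then so does `Q` (the coefficients of `Q`
are determined recursively by `P_m Q_n = R_{m+n} - ∑_{i > m} P_i Q_{m+n-i}`, `P_m` the lowest
non-zero coefficient). [folklore] -/
theorem PowerSeries.coeff_mem_of_mul_eq {P Q R : PowerSeries ℂ} (hP : P ≠ 0) (h : P * Q = R)
    (hPK : ∀ n, P.coeff n ∈ K) (hRK : ∀ n, R.coeff n ∈ K) : ∀ n, Q.coeff n ∈ K := by
  classical
  -- the order `m` of `P`
  have hex : ∃ m, P.coeff m ≠ 0 := by
    by_contra! hall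
    exact hP (PowerSeries.ext fun m ↦ by rw [hall m, map_zero])
  let m := Nat.find hex
  have hm : P.coeff m ≠ 0 := Nat.find_spec hex
  have hlt : ∀ i < m, P.coeff i = 0 := fun i hi ↦ by
    have := Nat.find_min hex hi
    simpa using this
  intro n
  induction n using Nat.strong_induction_on with
  | _ n ih =>
    -- the coefficient of `X^{m+n}` in `P Q = R`
    have hcoeff := congrArg (PowerSeries.coeff (m + n)) h
    rw [PowerSeries.coeff_mul] at hcoeff
    -- split off the term `(m, n)`
    rw [← Finset.add_sum_erase _ _ (Finset.HasAntidiagonal.mem_antidiagonal.mpr rfl : (m, n) ∈ Finset.HasAntidiagonal.antidiagonal (m + n))]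
      at hcoeff
    have hrest : ∑ p ∈ (Finset.HasAntidiagonal.antidiagonal (m + n)).erase (m, n), P.coeff p.1 * Q.coeff p.2 ∈ K := by
      refine sum_mem fun p hp ↦ ?_
      obtain ⟨hp2, hp1⟩ := Finset.mem_erase.mp hp
      have hsum : p.1 + p.2 = m + n := Finset.HasAntidiagonal.mem_antidiagonal.mp hp1
      rcases lt_or_ge p.1 m with h1 | h1
      · rw [hlt p.1 h1, zero_mul]; exact zero_mem K
      · have hne : p ≠ (m, n) := hp2
        have h2 : p.2 < n := by
          rcases lt_or_ge p.2 n with h2 | h2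
          · exact h2
          · exfalso
            have : p.1 = m ∧ p.2 = n := by omega
            exact hne (Prod.ext this.1 this.2)
        exact mul_mem (hPK _) (ih p.2 h2)
    have hsolve : Q.coeff n = (R.coeff (m + n) - ∑ p ∈ (Finset.HasAntidiagonal.antidiagonal (m + n)).erase (m, n),
        P.coeff p.1 * Q.coeff p.2) / P.coeff m := by
      rw [← hcoeff]
      field_simp
      ring
    rw [hsolve]
    exact div_mem (sub_mem (hRK _) hrest) (hPK m)

variable {N : ℕ} [NeZero N]

/-- **Division in `formSpace Γ(N)`**: if `d q = r` with `d ≢ 0`, `d`, `q`, `r` modular forms on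
`Γ(N)` and `d`, `r` have `K`-rational `q_N`-expansions, then so does `q`. [folklore] -/
theorem IsRat.of_mul_left {k₁ k₂ : ℤ} {d q r : ℍ → ℂ}
    (hd : d ∈ formSpace (CongruenceSubgroup.Gamma N) k₁) (hq : q ∈ formSpace (CongruenceSubgroup.Gamma N) k₂)
    (hd0 : d ≠ 0) (h : d * q = r)
    (hdK : IsRat K N d) (hrK : IsRat K N r) : IsRat K N q := by
  have hmul : qExpansion (N : ℝ) d * qExpansion (N : ℝ) q = qExpansion (N : ℝ) r := by
    rw [← qExpansion_mul (analyticAt_cuspFunction_of_mem hd) (analyticAt_cuspFunction_of_mem hq), h]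
  have hd0' : qExpansion (N : ℝ) d ≠ 0 := by
    obtain ⟨D, rfl⟩ := hd
    intro h0
    exact hd0 (congrArg DFunLike.coe
      ((ModularForm.qExpansion_eq_zero_iff (Nat.cast_pos.mpr (NeZero.pos N)) (natCast_mem_strictPeriods_Gamma N) D).mp h0))
  exact PowerSeries.coeff_mem_of_mul_eq hd0' hmul hdK hrK

end Division

/-! ### Translates of forms on `Γ(N)` -/

section Translates

variable {N : ℕ} [NeZero N]

/-- **`Γ(N)` is normal in `SL₂(ℤ)`**: the translate `f ∣_k γ` of `f ∈ M_k(Γ(N))` by `γ ∈ SL₂(ℤ)`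
lies in `M_k(Γ(N))`. [folklore] -/
theorem slash_mem_formSpace_Gamma {k : ℤ} {f : ℍ → ℂ}
    (hf : f ∈ formSpace (CongruenceSubgroup.Gamma N) k) (γ : SL(2, ℤ)) :
    f ∣[k] γ ∈ formSpace (CongruenceSubgroup.Gamma N) k := by
  have hf' := hf
  obtain ⟨F, hF⟩ := hf'
  rw [mem_formSpace_iff] at hf ⊢
  obtain ⟨-, hinv, hbdd⟩ := hf
  refine ⟨?_, ?_, ?_⟩
  · rw [← hF]
    exact (ModularForm.translate F (γ : GL (Fin 2) ℝ)).holo'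
  · intro δ hδ
    obtain ⟨g, hg, rfl⟩ := hδ
    have hconj : γ * g * γ⁻¹ ∈ CongruenceSubgroup.Gamma N :=
      (CongruenceSubgroup.Gamma_normal N).conj_mem g hg γ
    have h1 : f ∣[k] (γ * g * γ⁻¹) = f :=
      hinv (Matrix.SpecialLinearGroup.mapGL ℝ (γ * g * γ⁻¹)) ⟨_, hconj, rfl⟩
    show (f ∣[k] γ) ∣[k] g = f ∣[k] γ
    rw [← SlashAction.slash_mul, show γ * g = (γ * g * γ⁻¹) * γ by group, SlashAction.slash_mul, h1]
  · intro g
    have := hbdd (γ * g)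
    show IsBoundedAtImInfty ((f ∣[k] γ) ∣[k] g)
    rw [← SlashAction.slash_mul]
    exact this

end Translates

/-! ### Level one: a spanning set with rational `q`-expansions -/

section LevelOne

variable (K : Subfield ℂ) (N : ℕ) [NeZero N]

omit [NeZero N] in
/-- `Γ(N) ≤ SL₂(ℤ)` inside `GL(2, ℝ)`. [folklore] -/
theorem Gamma_le_SL :
    ((CongruenceSubgroup.Gamma N : Subgroup SL(2, ℤ)) : Subgroup (GL (Fin 2) ℝ)) ≤ 𝒮ℒ := by
  rintro _ ⟨g, -, rfl⟩
  exact ⟨g, rfl⟩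

/-- Level-one forms are forms on `Γ(N)`. [folklore] -/
theorem mem_formSpace_Gamma_of_levelOne {w : ℤ} {p : ℍ → ℂ} (hp : p ∈ levelOneSpace w) :
    p ∈ formSpace (CongruenceSubgroup.Gamma N) w :=
  formSpace_mono (Gamma_le_SL N) hp

variable {N} in
/-- A level-one modular form with integral `q`-expansion (period `1`) has a `K`-rational
`q_N`-expansion (its `q_N`-expansion is the `q`-expansion in `q = q_N^N`). [folklore] -/
theorem isRat_of_levelOne_int {w : ℤ} (F : ModularForm 𝒮ℒ w) (P₀ : PowerSeries ℤ)
    (hP : P₀.map (Int.castRingHom ℂ) = qExpansion 1 ⇑F) : IsRat K N ⇑F := by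
  intro n
  rw [coeff_qExpansion_nat_eq F Subgroup.strictPeriods_SL2Z N n]
  split_ifs
  · rw [← hP, PowerSeries.coeff_map, eq_intCast]
    exact intCast_mem K _
  · exact zero_mem K

/-- `E₄` has a rational `q_N`-expansion. [folklore] -/
theorem isRat_E4 : IsRat K N (⇑E₄ : ℍ → ℂ) := by
  obtain ⟨P₀, -, hP⟩ := exists_int_map_eq_qExpansion_E₄
  exact isRat_of_levelOne_int K E₄ P₀ hP

/-- `E₆` has a rational `q_N`-expansion. [folklore] -/
theorem isRat_E6 : IsRat K N (⇑E₆ : ℍ → ℂ) := by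
  obtain ⟨P₀, -, hP⟩ := exists_int_map_eq_qExpansion_E₆
  exact isRat_of_levelOne_int K E₆ P₀ hP

/-- **`M_w(SL₂(ℤ))` is spanned over `ℂ` by forms with `K`-rational `q_N`-expansions** (indeed by
the monomials `E₄^a E₆^b`, `4a + 6b = w`, which have rational `q`-expansions): by induction on
the weight from the tree's `levelOneSpace_le_sup` (`R_w ⊆ E₄R_{w-4} + E₆R_{w-6}`), the constants in
weight `0`, and `R_w = 0` for `w < 0`.  (Shimura (6.1.3): `M_k(SL₂(ℤ))` has a basis with rational
Fourier coefficients.) [cite: ShimuraIATAF1971, §6.1 (6.1.3)] -/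
theorem levelOneSpace_le_span_isRat (w : ℤ) :
    levelOneSpace w ≤ Submodule.span ℂ {m | m ∈ levelOneSpace w ∧ IsRat K N m} := by
  suffices h : ∀ (n : ℕ) (w : ℤ), w.toNat = n →
      levelOneSpace w ≤ Submodule.span ℂ {m | m ∈ levelOneSpace w ∧ IsRat K N m} from h _ w rfl
  intro n
  induction n using Nat.strong_induction_on with
  | _ n ih =>
  intro w hw
  rcases lt_or_ge w 0 with hneg | hnonneg
  · rw [show levelOneSpace w = ⊥ from formSpace_eq_bot_of_neg hneg]
    exact bot_le
  rcases eq_or_ne w 0 with rfl | hw0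
  · -- weight `0`: constants
    rintro f ⟨F, rfl⟩
    obtain ⟨c, hc⟩ := ModularFormClass.levelOne_weight_zero_const F
    have h1 : (⇑F : ℍ → ℂ) = c • (1 : ℍ → ℂ) := by
      rw [hc]; funext z; simp
    rw [h1]
    refine Submodule.smul_mem _ c (Submodule.subset_span ⟨⟨1, ModularForm.one_coe_eq_one⟩, isRat_one⟩)
  -- `w > 0`: `R_w ⊆ E₄ R_{w-4} + E₆ R_{w-6}` and induction
  intro f hf
  have hdec := levelOneSpace_le_sup hw0 hf
  rw [Submodule.mem_sup] at hdec
  obtain ⟨_, ⟨f₁, hf₁, rfl⟩, _, ⟨f₂, hf₂, rfl⟩, hsum⟩ := hdec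
  rw [← hsum]
  simp only [LinearMap.mulLeft_apply]
  have h4 : (w - 4).toNat < n := by omega
  have h6 : (w - 6).toNat < n := by omega
  have hs₁ := ih _ h4 (w - 4) rfl hf₁
  have hs₂ := ih _ h6 (w - 6) rfl hf₂
  -- multiplication by `E₄` (resp. `E₆`) maps the rational span of weight `w-4` (resp. `w-6`)
  -- into the rational span of weight `w`
  have hmul : ∀ (E : ℍ → ℂ) (v : ℤ), E ∈ levelOneSpace v → IsRat K N E → ∀ g : ℍ → ℂ,
      g ∈ Submodule.span ℂ {m | m ∈ levelOneSpace (w - v) ∧ IsRat K N m} →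
      E * g ∈ Submodule.span ℂ {m | m ∈ levelOneSpace w ∧ IsRat K N m} := by
    intro E v hE hEK g hg
    refine Submodule.span_induction (p := fun g _ ↦ E * g ∈ Submodule.span ℂ
      {m | m ∈ levelOneSpace w ∧ IsRat K N m}) ?_ ?_ ?_ ?_ hg
    · rintro m ⟨hm, hmK⟩
      refine Submodule.subset_span ⟨?_, ?_⟩
      · have := mul_mem_formSpace hE hm
        rwa [show v + (w - v) = w by ring] at this
      · exact IsRat.mul (mem_formSpace_Gamma_of_levelOne N hE) (mem_formSpace_Gamma_of_levelOne N hm)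
          hEK hmK
    · rw [mul_zero]; exact Submodule.zero_mem _
    · intro x y _ _ hx hy
      rw [mul_add]; exact Submodule.add_mem _ hx hy
    · intro a x _ hx
      rw [mul_smul_comm]; exact Submodule.smul_mem _ a hx
  refine Submodule.add_mem _ (hmul _ 4 E4_mem (isRat_E4 K N) f₁ ?_) (hmul _ 6 E6_mem (isRat_E6 K N) f₂ ?_)
  · exact hs₁
  · exact hs₂

end LevelOne

/-! ### Descent of linear relations from `ℂ` to `K` -/

section Descent

variable (K : Subfield ℂ)

/-- A `K`-linear retraction `ρ : ℂ → K` of the inclusion (`ℂ` is a `K`-vector space). [folklore] -/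
theorem exists_linear_retraction :
    ∃ ρ : ℂ →ₗ[K] K, ∀ x : K, ρ (x : ℂ) = x := by
  have hinj : LinearMap.ker (Algebra.linearMap K ℂ) = ⊥ := by
    rw [LinearMap.ker_eq_bot]
    exact Subtype.val_injective
  obtain ⟨ρ, hρ⟩ := LinearMap.exists_leftInverse_of_injective (Algebra.linearMap K ℂ) hinj
  refine ⟨ρ, fun x ↦ ?_⟩
  have := congrArg (fun f ↦ f x) hρ
  exact this

/-- **Descent of linear relations**: if a sequence `P : ℕ → ℂ` with values in `K` is a
`ℂ`-linear combination `P = ∑_j c_j v_j` of finitely many sequences `v_j` with values in `K`,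
then it is a `K`-linear combination of them (apply a `K`-linear retraction `ℂ → K`
coefficientwise).  This is the linear disjointness of `ℂ` and `K((q))` over `K` in Shimura's
proof of Prop. 6.9. [cite: ShimuraIATAF1971, Prop. 6.9 (proof)] -/
theorem exists_coords_mem_of_forall_mem {ι : Type*} [Fintype ι] (v : ι → ℕ → ℂ)
    (hv : ∀ j n, v j n ∈ K) (c : ι → ℂ) (P : ℕ → ℂ) (hP : ∀ n, P n ∈ K)
    (h : ∀ n, P n = ∑ j, c j * v j n) :
    ∃ c' : ι → ℂ, (∀ j, c' j ∈ K) ∧ ∀ n, P n = ∑ j, c' j * v j n := by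
  obtain ⟨ρ, hρ⟩ := exists_linear_retraction K
  refine ⟨fun j ↦ (ρ (c j) : ℂ), fun j ↦ (ρ (c j)).2, fun n ↦ ?_⟩
  have h1 : (ρ (P n) : ℂ) = P n := by
    have := hρ ⟨P n, hP n⟩
    exact congrArg Subtype.val this
  rw [← h1, h n, map_sum]
  push_cast
  refine Finset.sum_congr rfl fun j _ ↦ ?_
  have h2 : c j * v j n = (⟨v j n, hv j n⟩ : K) • c j := by
    rw [Subfield.smul_def, smul_eq_mul, mul_comm]
  rw [h2, map_smul, smul_eq_mul]
  push_cast
  ring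

end Descent

end Literature.NumberTheory.ModularForms

end
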